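import Summits.ResolutionOfSingularities.ResolutionOfSingularities.Theorems.WeightedInvariantContactCylinderOpenPresentation
import Summits.ResolutionOfSingularities.ResolutionOfSingularities.Theorems.WeightedInvariantContactCylinderDefs
import HarnessLib

/-!
# The cylinder and the top stratum under GENERISATION: `cylinderAt` / `jCylinder` localise — the (strat) J-conjunct of
# `CanonicalGameClause` for the cylinder construction of ORDER (o28)
# (door `HypersurfaceCentreConstruction`, stmt-ResolutionOfSingularities-19897; KEY `stub_localWeightedDropEFT4S` beyond the
# P2 rung, regime P3a «the top stratum through the closed point is a regular germ of codimension two»)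

Topic: `Summits/ResolutionOfSingularities/ResolutionOfSingularities/Theorems`. Helper for the door item
`HypersurfaceCentreConstruction` (stmt-ResolutionOfSingularities-19897, route `WeightedInvariant`), line `local-engine` of
res-L1-w43-plan-1 (L W4.3), ORDER (o28) (lead res-type-005, co-hand res-D-brk-1).  Uses res-type-005's (D1) definitions
`cylinderAt` / `topStratum` / `jCylinder` (p524206).

THE OBSERVATION.  For primes `𝔭 ≤ 𝔮` of ANY commutative ring `A` and ANY iso-invariant `J`, the cylinder over `𝔭`
LOCALISES: `cylinderAt J (A_𝔮) (𝔭 A_𝔮) (F/1) m = (cylinderAt J A 𝔭 F m) · A_𝔮` — every ideal of the localisation `A_𝔮`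
is the extension of its contraction (Mathlib `IsLocalization.map_under`), and the contraction of the left side to `A` is
`(J (A_𝔭) F m) ∩ A` because `(A_𝔮)_{𝔭 A_𝔮} ≃ A_𝔭` over `A` (`IsLocalization.algEquiv`, `JIsoInvariant`).  No regularity, no
P2 data, no primary decomposition.  Consequences: the J-half of the (strat) conjunct of `CanonicalGameClauseLE`
(«`J (S_𝔭) (f) m = (J S f m) · S_𝔭` for the primes `𝔭 ⊇ P` of the centre») for the candidate `J₃ = jCylinder ι jContact` in
regime P3a, once the top `ι`-stratum of `S_𝔮` is identified with `V(P S_𝔮)` — done here for `ι = iotaOrd`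
(`topStratum_iotaOrd_localization_of_eq`, from `iotaOrd_isoInvariant` along `(S_𝔮)_{𝔮₀ S_𝔮} ≃ S_{𝔮₀}`).

## Contents (sorry-free, standard axioms; NO definitions)

* **`cylinderAt_localization`** — `cylinderAt J (A_𝔮) (𝔭 A_𝔮) (F/1) m = (cylinderAt J A 𝔭 F m).map (A → A_𝔮)` for
  `JIsoInvariant J`, `𝔭 ≤ 𝔮` (any commutative ring).
* `cylinder_localization_compatible` — the same for `J = jContact` (res-type-092's `jContact_isoInvariant`), unfolded;
  `cylinder_localization_eq_map_weightedMonomialIdeal` — in regime P3a (`S` regular local, `𝔭 = (x, g)` with independent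
  differentials, P2 data at `S_𝔭`) both sides are `(x, g; 1, b_max)_m · S_𝔮` (the VALUE p522408), at EVERY prime `𝔮 ⊇ 𝔭`
  (no condition at `𝔮`).
* `iotaOrd_atPrime_atPrime_map_eq` — `iotaOrd ((A_𝔮)_{𝔭 A_𝔮}) F = iotaOrd (A_𝔭) F`;
  `mem_topStratum_iotaOrd_localization_iff`, **`topStratum_iotaOrd_localization_of_eq`** — if the top order-stratum of `S`
  is `V(𝔭)` and `𝔭 ≤ 𝔮`, the top order-stratum of `S_𝔮` is `V(𝔭 S_𝔮)`.
* **`jCylinder_iotaOrd_jContact_localization`** — `jCylinder iotaOrd jContact (S_𝔮) (f/1) m = (jCylinder iotaOrd jContact S f m) · S_𝔮`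
  for every prime `𝔮 ⊇ 𝔭` when the top order-stratum of `S` is `V(𝔭)` (ANY commutative ring `S`, any `f`).

[OURS · L1 W4.3 · (o28) P3a probe]  Replaces the role of NO printed item; NOT a statement of the manuscript
[claim: Hironaka2017, status: under-review]. AI work, weaker than expert review.  Pure commutative algebra; no named facts.

## References

* H. Matsumura, *Commutative Ring Theory* (1987), Thm. 4.1–4.3 (ideals of a localisation, localisation of a
  localisation). [Matsumura1987]
* res-type-005, `plan/tools/res-type-005/o28/P3A-PROBE.md` v2 §5 (OURS, AI design input).
-/

noncomputable section

open IsLocalRing Literature.AlgebraicGeometry.Resolution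
open Summit.ResolutionOfSingularities.ResolutionOfSingularities.Cruxes.HypersurfaceCentreConstruction.LocalEngine

set_option linter.dupNamespace false -- mandated namespace of this single-conjunct summit

namespace Summit.ResolutionOfSingularities.ResolutionOfSingularities.Theorems

namespace ContactCylinder

/-! ## The cylinder over `𝔭` localises -/

/-- **The cylinder over a prime LOCALISES.**  `A` any commutative ring, `𝔭 ≤ 𝔮` primes, `J` invariant under ring
isomorphisms.  Then `cylinderAt J (A_𝔮) (𝔭 A_𝔮) (F/1) m = (cylinderAt J A 𝔭 F m) · A_𝔮`: the left side is an ideal of the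
localisation `A_𝔮`, hence the extension of its contraction to `A` (`IsLocalization.map_under`), and that contraction is
`(J (A_𝔭) (F/1) m) ∩ A` along the `A`-isomorphism `(A_𝔮)_{𝔭 A_𝔮} ≃ A_𝔭`. [cite: Matsumura1987, Thm. 4.1 and Thm. 4.3] -/
theorem cylinderAt_localization (J : (R : Type) → [CommRing R] → R → ℕ → Ideal R) (hJ : JIsoInvariant J)
    (A : Type) [CommRing A] (𝔭 𝔮 : Ideal A) [𝔭.IsPrime] [𝔮.IsPrime] (h𝔭𝔮 : 𝔭 ≤ 𝔮)
    [(𝔭.map (algebraMap A (Localization.AtPrime 𝔮))).IsPrime] (F : A) (m : ℕ) :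
    cylinderAt J (Localization.AtPrime 𝔮) (𝔭.map (algebraMap A (Localization.AtPrime 𝔮)))
        (algebraMap A (Localization.AtPrime 𝔮) F) m =
      (cylinderAt J A 𝔭 F m).map (algebraMap A (Localization.AtPrime 𝔮)) := by
  haveI := isLocalizationAtPrime_atPrime_map 𝔭 𝔮 h𝔭𝔮
  let e : Localization.AtPrime (𝔭.map (algebraMap A (Localization.AtPrime 𝔮))) ≃+* Localization.AtPrime 𝔭 :=
    (IsLocalization.algEquiv 𝔭.primeCompl
      (Localization.AtPrime (𝔭.map (algebraMap A (Localization.AtPrime 𝔮)))) (Localization.AtPrime 𝔭)).toRingEquiv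
  have he : ∀ a : A, e (algebraMap A _ a) = algebraMap A (Localization.AtPrime 𝔭) a := fun a =>
    (IsLocalization.algEquiv 𝔭.primeCompl
      (Localization.AtPrime (𝔭.map (algebraMap A (Localization.AtPrime 𝔮)))) (Localization.AtPrime 𝔭)).commutes a
  rw [cylinderAt_def, cylinderAt_def,
    ← IsLocalization.map_under 𝔮.primeCompl (Localization.AtPrime 𝔮)
      ((J (Localization.AtPrime (𝔭.map (algebraMap A (Localization.AtPrime 𝔮)))) _ m).comap (algebraMap _ _))]
  congr 1
  rw [Ideal.under_def, Ideal.comap_comap,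
    ← IsScalarTower.algebraMap_eq A (Localization.AtPrime 𝔮)
      (Localization.AtPrime (𝔭.map (algebraMap A (Localization.AtPrime 𝔮)))),
    ← IsScalarTower.algebraMap_apply A (Localization.AtPrime 𝔮)
      (Localization.AtPrime (𝔭.map (algebraMap A (Localization.AtPrime 𝔮)))) F]
  ext a
  rw [Ideal.mem_comap, Ideal.mem_comap, ← he F, ← he a, hJ _ _ e _ m, Ideal.apply_mem_of_equiv_iff]

/-- **The cylinder of `jContact` localises** (res-type-092's `jContact_isoInvariant`): for primes `𝔭 ≤ 𝔮` of any
commutative ring, `(jContact ((A_𝔮)_{𝔭A_𝔮}) (F/1) m) ∩ A_𝔮 = ((jContact (A_𝔭) (F/1) m) ∩ A) · A_𝔮`. [OURS · L1 W4.3 · (o28)] -/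
theorem cylinder_localization_compatible (A : Type) [CommRing A] (𝔭 𝔮 : Ideal A) [𝔭.IsPrime] [𝔮.IsPrime]
    (h𝔭𝔮 : 𝔭 ≤ 𝔮) [(𝔭.map (algebraMap A (Localization.AtPrime 𝔮))).IsPrime] (F : A) (m : ℕ) :
    (jContact (Localization.AtPrime (𝔭.map (algebraMap A (Localization.AtPrime 𝔮))))
        (algebraMap A _ F) m).comap
        (algebraMap (Localization.AtPrime 𝔮) (Localization.AtPrime (𝔭.map (algebraMap A (Localization.AtPrime 𝔮))))) =
      ((jContact (Localization.AtPrime 𝔭) (algebraMap A (Localization.AtPrime 𝔭) F) m).comap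
        (algebraMap A (Localization.AtPrime 𝔭))).map (algebraMap A (Localization.AtPrime 𝔮)) := by
  have h := cylinderAt_localization jContact jContact_isoInvariant A 𝔭 𝔮 h𝔭𝔮 F m
  rw [cylinderAt_def, cylinderAt_def,
    ← IsScalarTower.algebraMap_apply A (Localization.AtPrime 𝔮)
      (Localization.AtPrime (𝔭.map (algebraMap A (Localization.AtPrime 𝔮)))) F] at h
  exact h

/-- **In regime P3a the localised cylinder is again presented by `(x, g; 1, b_max)`**: `S` regular local, `𝔭 = (x, g)` with
independent differentials, the P2 data at `S_𝔭` (VALUE p522408); then at EVERY prime `𝔮 ⊇ 𝔭` — no condition at `𝔮` —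
`(jContact ((S_𝔮)_{𝔭S_𝔮}) (f/1) m) ∩ S_𝔮 = (x, g; 1, b_max)_m · S_𝔮`. [OURS · L1 W4.3 · (o28)] -/
theorem cylinder_localization_eq_map_weightedMonomialIdeal (S : Type) [CommRing S] [IsRegularLocalRing S] (x g : S)
    (hxg : ∀ i, (![x, g] : Fin 2 → S) i ∈ maximalIdeal S)
    (hli : LinearIndependent (ResidueField S) (fun i => (maximalIdeal S).toCotangent ⟨(![x, g] : Fin 2 → S) i, hxg i⟩))
    [(Ideal.span {x, g}).IsPrime] (f : S)
    (hf0 : algebraMap S (Localization.AtPrime (Ideal.span {x, g})) f ≠ 0)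
    (hnm : ¬ IsMonomialType (algebraMap S (Localization.AtPrime (Ideal.span {x, g})) f))
    (hreach : algebraMap S (Localization.AtPrime (Ideal.span {x, g})) f ∈
      contactFiltration (algebraMap S (Localization.AtPrime (Ideal.span {x, g})) g)
        (bMax (algebraMap S (Localization.AtPrime (Ideal.span {x, g})) f))
        (bMax (algebraMap S (Localization.AtPrime (Ideal.span {x, g})) f) *
          (adicOrder (algebraMap S (Localization.AtPrime (Ideal.span {x, g})) f)).toNat))
    (hb : 1 ≤ bMax (algebraMap S (Localization.AtPrime (Ideal.span {x, g})) f))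
    (𝔮 : Ideal S) [𝔮.IsPrime] (h𝔭𝔮 : Ideal.span {x, g} ≤ 𝔮)
    [((Ideal.span {x, g}).map (algebraMap S (Localization.AtPrime 𝔮))).IsPrime] (m : ℕ) :
    (jContact (Localization.AtPrime ((Ideal.span {x, g}).map (algebraMap S (Localization.AtPrime 𝔮))))
        (algebraMap S _ f) m).comap
        (algebraMap (Localization.AtPrime 𝔮)
          (Localization.AtPrime ((Ideal.span {x, g}).map (algebraMap S (Localization.AtPrime 𝔮))))) =
      (weightedMonomialIdeal ![x, g] ![1, bMax (algebraMap S (Localization.AtPrime (Ideal.span {x, g})) f)] m).map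
        (algebraMap S (Localization.AtPrime 𝔮)) := by
  rw [cylinder_localization_compatible S (Ideal.span {x, g}) 𝔮 h𝔭𝔮 f m,
    cylinder_comap_eq_weightedMonomialIdeal S x g hxg hli f hf0 hnm hreach hb m]

/-! ## The top order-stratum under generisation -/

/-- `iotaOrd ((A_𝔮)_{𝔭 A_𝔮}) F = iotaOrd (A_𝔭) F` for primes `𝔭 ≤ 𝔮` (`iotaOrd_isoInvariant` along `(A_𝔮)_{𝔭A_𝔮} ≃ A_𝔭`).
[cite: Matsumura1987, Thm. 4.3] -/
theorem iotaOrd_atPrime_atPrime_map_eq (A : Type) [CommRing A] (𝔭 𝔮 : Ideal A) [𝔭.IsPrime] [𝔮.IsPrime]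
    (h𝔭𝔮 : 𝔭 ≤ 𝔮) [(𝔭.map (algebraMap A (Localization.AtPrime 𝔮))).IsPrime] (F : A) :
    iotaOrd (Localization.AtPrime (𝔭.map (algebraMap A (Localization.AtPrime 𝔮)))) (algebraMap A _ F) =
      iotaOrd (Localization.AtPrime 𝔭) (algebraMap A (Localization.AtPrime 𝔭) F) := by
  haveI := isLocalizationAtPrime_atPrime_map 𝔭 𝔮 h𝔭𝔮
  let e : Localization.AtPrime (𝔭.map (algebraMap A (Localization.AtPrime 𝔮))) ≃+* Localization.AtPrime 𝔭 :=
    (IsLocalization.algEquiv 𝔭.primeCompl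
      (Localization.AtPrime (𝔭.map (algebraMap A (Localization.AtPrime 𝔮)))) (Localization.AtPrime 𝔭)).toRingEquiv
  have he : e (algebraMap A _ F) = algebraMap A (Localization.AtPrime 𝔭) F :=
    (IsLocalization.algEquiv 𝔭.primeCompl
      (Localization.AtPrime (𝔭.map (algebraMap A (Localization.AtPrime 𝔮)))) (Localization.AtPrime 𝔭)).commutes F
  rw [← he, iotaOrd_isoInvariant _ _ e]

/-- A prime `𝔮₀'` of `S_𝔮` lies on the top order-stratum of `f/1 ∈ S_𝔮` iff `ord_{S_{𝔮₀' ∩ S}}(f) = ord_{S_𝔮}(f)`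
(`(S_𝔮)_{𝔮₀'} ≃ S_{𝔮₀' ∩ S}`, Mathlib `IsLocalization.isLocalization_atPrime_localization_atPrime`). [cite: Matsumura1987, Thm. 4.3] -/
theorem mem_topStratum_iotaOrd_localization_iff (S : Type) [CommRing S] (𝔮 : Ideal S) [𝔮.IsPrime] (f : S)
    (𝔮₀' : PrimeSpectrum (Localization.AtPrime 𝔮)) :
    𝔮₀' ∈ topStratum iotaOrd (Localization.AtPrime 𝔮) (algebraMap S (Localization.AtPrime 𝔮) f) ↔
      iotaOrd (Localization.AtPrime (𝔮₀'.asIdeal.comap (algebraMap S (Localization.AtPrime 𝔮))))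
          (algebraMap S _ f) =
        iotaOrd (Localization.AtPrime 𝔮) (algebraMap S (Localization.AtPrime 𝔮) f) := by
  rw [mem_topStratum_iff]
  let e : Localization.AtPrime 𝔮₀'.asIdeal ≃+*
      Localization.AtPrime (𝔮₀'.asIdeal.comap (algebraMap S (Localization.AtPrime 𝔮))) :=
    (IsLocalization.algEquiv (𝔮₀'.asIdeal.comap (algebraMap S (Localization.AtPrime 𝔮))).primeCompl
      (Localization.AtPrime 𝔮₀'.asIdeal)
      (Localization.AtPrime (𝔮₀'.asIdeal.comap (algebraMap S (Localization.AtPrime 𝔮))))).toRingEquiv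
  have he : e (algebraMap S _ f) = algebraMap S _ f :=
    (IsLocalization.algEquiv (𝔮₀'.asIdeal.comap (algebraMap S (Localization.AtPrime 𝔮))).primeCompl
      (Localization.AtPrime 𝔮₀'.asIdeal)
      (Localization.AtPrime (𝔮₀'.asIdeal.comap (algebraMap S (Localization.AtPrime 𝔮))))).commutes f
  rw [← IsScalarTower.algebraMap_apply S (Localization.AtPrime 𝔮) (Localization.AtPrime 𝔮₀'.asIdeal) f,
    ← iotaOrd_isoInvariant _ _ e, he]

/-- **The top order-stratum under generisation**: if the top order-stratum of `S` through the closed point is `V(𝔭)` and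
`𝔭 ≤ 𝔮`, then the top order-stratum of `S_𝔮` through ITS closed point is `V(𝔭 S_𝔮)` (the order at `S_𝔮` equals the order
at `S` because `𝔮` lies on the stratum; the primes of `S_𝔮` are the primes `𝔮₀ ⊆ 𝔮` of `S` with the same local rings).
[OURS · L1 W4.3 · (o28)] -/
theorem topStratum_iotaOrd_localization_of_eq (S : Type) [CommRing S] (𝔭 𝔮 : Ideal S) [𝔭.IsPrime] [𝔮.IsPrime]
    (h𝔭𝔮 : 𝔭 ≤ 𝔮) (f : S) (hE : topStratum iotaOrd S f = {𝔮₁ | 𝔭 ≤ 𝔮₁.asIdeal}) :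
    topStratum iotaOrd (Localization.AtPrime 𝔮) (algebraMap S (Localization.AtPrime 𝔮) f) =
      {𝔮₀' | 𝔭.map (algebraMap S (Localization.AtPrime 𝔮)) ≤ 𝔮₀'.asIdeal} := by
  -- the order at `S_𝔮` is the order at `S`
  have h𝔮 : iotaOrd (Localization.AtPrime 𝔮) (algebraMap S (Localization.AtPrime 𝔮) f) = iotaOrd S f := by
    have : (⟨𝔮, ‹_›⟩ : PrimeSpectrum S) ∈ topStratum iotaOrd S f := by rw [hE]; exact h𝔭𝔮
    exact this
  ext 𝔮₀'
  rw [mem_topStratum_iotaOrd_localization_iff, h𝔮, Set.mem_setOf_eq, Ideal.map_le_iff_le_comap]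
  have h := Set.ext_iff.mp hE ⟨𝔮₀'.asIdeal.comap (algebraMap S (Localization.AtPrime 𝔮)), inferInstance⟩
  rw [mem_topStratum_iff, Set.mem_setOf_eq] at h
  exact h

/-- The generic prime of the top order-stratum of `S_𝔮` is `𝔭 S_𝔮` when that of `S` is `V(𝔭)` and `𝔭 ≤ 𝔮`. [folklore] -/
theorem topStratumPrime_iotaOrd_localization_eq (S : Type) [CommRing S] (𝔭 𝔮 : Ideal S) [𝔭.IsPrime] [𝔮.IsPrime]
    (h𝔭𝔮 : 𝔭 ≤ 𝔮) (f : S) (hE : topStratum iotaOrd S f = {𝔮₁ | 𝔭 ≤ 𝔮₁.asIdeal})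
    [(𝔭.map (algebraMap S (Localization.AtPrime 𝔮))).IsPrime] :
    topStratumPrime iotaOrd (Localization.AtPrime 𝔮) (algebraMap S (Localization.AtPrime 𝔮) f) =
      𝔭.map (algebraMap S (Localization.AtPrime 𝔮)) :=
  topStratumPrime_eq_of_topStratum_eq iotaOrd _ _ (topStratum_iotaOrd_localization_of_eq S 𝔭 𝔮 h𝔭𝔮 f hE)

/-! ## (strat), J-half, for the candidate pair `(iotaOrd, jCylinder iotaOrd jContact)` -/

/-- **The cylinder construction LOCALISES along the stratum** ((strat) J-half of `CanonicalGameClause` for the candidate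
pair `(iotaOrd, jCylinder iotaOrd jContact)`): `S` ANY commutative ring, `f ∈ S` whose top order-stratum through the closed
point is `V(𝔭)` for a prime `𝔭`, and `𝔮 ⊇ 𝔭` a prime.  Then for every `m`:
`jCylinder iotaOrd jContact (S_𝔮) (f/1) m = (jCylinder iotaOrd jContact S f m) · S_𝔮`. [OURS · L1 W4.3 · (o28)] -/
theorem jCylinder_iotaOrd_jContact_localization (S : Type) [CommRing S] (𝔭 𝔮 : Ideal S) [𝔭.IsPrime] [𝔮.IsPrime]
    (h𝔭𝔮 : 𝔭 ≤ 𝔮) (f : S) (hE : topStratum iotaOrd S f = {𝔮₁ | 𝔭 ≤ 𝔮₁.asIdeal}) (m : ℕ) :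
    jCylinder iotaOrd jContact (Localization.AtPrime 𝔮) (algebraMap S (Localization.AtPrime 𝔮) f) m =
      (jCylinder iotaOrd jContact S f m).map (algebraMap S (Localization.AtPrime 𝔮)) := by
  haveI := isPrime_map_atPrime_of_le 𝔭 𝔮 h𝔭𝔮
  rw [jCylinder_eq_of_topStratum_eq iotaOrd jContact _ _ m (topStratum_iotaOrd_localization_of_eq S 𝔭 𝔮 h𝔭𝔮 f hE),
    jCylinder_eq_of_topStratum_eq iotaOrd jContact S f m hE,
    ← IsScalarTower.algebraMap_apply S (Localization.AtPrime 𝔮) _ f]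
  exact cylinder_localization_compatible S 𝔭 𝔮 h𝔭𝔮 f m

end ContactCylinder

end Summit.ResolutionOfSingularities.ResolutionOfSingularities.Theorems

end
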